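import Summits.QuantumFields.BalabanUV.Beta.GAN24.BlockDivergenceFlux

/-!
# `BalabanUV.Beta.GAN24.LayerFluxSupport` — binder row G-an2-4 / (CONV-C), CT-W route «WC-TL» → «QR-LL» (the OWNER gan24-p1 g25's
# `gen25/QR-DESIGN-v0.md` 66f87a030fd031ac §3 (LAY), support lemma (A)):
# **THE FLUX LETTER `T(∇1_B, ·)` — THE BLOCK-SUMMED DIVERGENCE OF A BI-STENCIL — LIVES NEAR THE BOUNDARY LAYER OF THE BLOCK**

NOT IN PRINT; OUR BOOKKEEPING (G-an2-4 formalisation swarm → CRUX TEAM (2), leaf prover `b2b-balaban-gan24-formalise-leaf-03`, gen 58; INTENT 6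
«(LAY) SUPPORT (A)», journal `CLAIMS.log`; names PROVISIONAL — the OWNER ∕ leaf-01 ((LT) consumer) may rename ∕ re-cut).  [folklore] the triangle
inequality over this lineage's `BlockDivergenceFlux.finsetSum_divV_eq_layers` and the tree's `LocStencil₂` ∕ `BiLoc` ∕ `Zl` (`ExpKernelCalculus.tsum_exp_shift'`)
BY NAME; generic `d`; 0 `def`, 0 cited facts, 0 `def … : Prop`, 0 sorry.  HONEST FRAMING (cell contract, verbatim): «discharging `BetaPertH` makes Bałaban's
UV stability UNCONDITIONAL — a real constructive-QFT result; it is NOT the continuum limit and NOT the Clay problem.»  HONEST DEPENDENCY (verbatim):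
«continuum YM on T⁴ ⇐ BetaPertH ∧ nine spine estimates (0/9 proved); BetaPertH ⇐ (D1) ∧ (D4) ∧ CAP+tail; G-an2-4 gates asym, D1 and NE2/3/4.»

## What
The |S| = 1 ∕ |S| = 2 storeys of the Ward-locus ∕ T2 remainder tower (`Lin4SlotDivergence.divW_lin4_of_symm`, `E3SlotDivergence.divV_e3OfK`) read a
table `T` ONLY through the kernel-valued stencil `(κ,u) ↦ Σ_{x′∈B} divV (T κ u) x′` — the table paired with `∇1_B` (QR-DESIGN §2 (P1)).  By
`BlockDivergenceFlux.finsetSum_divV_eq_layers` that is a SIGNED SUM OF `T κ u μ w` OVER THE DISCRETE BOUNDARY LAYER of `B` (inner faces `B ∖ (B − e_μ)`,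
outer faces `(B − e_μ) ∖ B`).  THIS FILE bounds it:
* §2 WEIGHT FORM (exact bookkeeping, any real `δ`) **`biLoc_finsetSum_divV_weight`**: `LocStencil₂ T C δ` ⇒ `BiLoc (Σ_{x′∈B} divV (T κ u) x′) u u (C·ω_B(u)) δ`,
  `ω_B(u) := Σ_μ (Σ_{outer face} + Σ_{inner face}) e^{−δ|w−u|₁}` written out (no `def`) — the rate in the kernel variables is KEPT.
* §3 ENVELOPE (`0 < δ`) `sum_exp_le_of_far`, **`faceWeight_le`**: `ω_B(u) ≤ 2(d+1)·Zl_{d+1}(δ∕2)·e^{−(δ∕2)R}` for every WITNESS `R` of the `ℓ¹`-distance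
  from `u` to the layer (`hR : ∀ μ w, w ∈ layer_μ(B) → R ≤ |w − u|₁`; no `dist` is defined, as leaf-01 g63's LT-STATEMENT-v0 §3 asks) — uniformly in `B`
  (each face sum is dominated by the full lattice sum; crude by the factor «face ∕ lattice» but N-FREE, which is what (LT) needs); hence
  **`biLoc_finsetSum_divV`**: `BiLoc (Σ_{x′∈B} divV (T κ u) x′) u u (C·2(d+1)·Zl_{d+1}(δ∕2)·e^{−(δ∕2)R}) δ` and the bulk case `R = 0` `biLoc_finsetSum_divV_zero`.
* §2′ THE INTERFACE FORM (RULING R-gan24p1-g25-2 (2), the primary statement for (LT)): **`finsetSum_divV_eq_faceDiff`** — per direction `μ` the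
  OUTER-face sum minus the INNER-face sum of the SAME table, UNSUMMED — with EACH face sum bounded separately: **`biLoc_faceSum_weight`** (exact weight
  `C·Σ_{w∈F} e^{−δ|w−u|₁}`, any finite `F`) and **`biLoc_faceSum`** (F-free envelope `C·Zl_{d+1}(δ∕2)·e^{−(δ∕2)R_F}`); §2–§3's total bounds are the corollary.
* §4 ONE BLOCK (the storeys' literal input `Σ_{v∈box} divV (T κ u) (N•y + toSite v)`): `boxSum_divV_eq_finsetSum`, **`biLoc_boxSum_divV`**, `biLoc_boxSum_divV_zero`.
= QR-DESIGN-v0 §3 (LAY) «`LocStencil₂ T C δ` ⇒ `T(∇1_B, κ′u′)` is `BiLoc` at `u′` with constant `C·e^{−δ·dist(u′,∂B)∕2}`» (here: rate `δ` kept in the kernel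
variables, `δ∕2` only in the envelope; `dist` in witness form).  ANSWER to leaf-01 g63 §5 «`0 ≤ ω ≤ 1`?»: the exact weight `ω_B` is NOT `≤ 1` (corners), but
`≤ W·e^{−(δ∕2)R}` with the B-free `W = 2(d+1)·Zl_{d+1}(δ∕2)` — fold `W` into the letter constant.  Sister file: `LayerCommutatorSupport` (the `[S, X_B]` letter).
DISCHARGES NO ROW: (LAY)'s letter bounds proper, (LT), the END and (Q-R) are NOT here; 0 estimate of Bałaban's; NOTHING of «T2Shape» ∕ «T2Drift» ∕ (hW, hWall) ∕ (C)
discharged; NEVER «G-an2-4 closed» as (CONV-C); NOT D1, NOT BetaPertH, NOT continuum, NOT Clay.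
-/

namespace Summit.QuantumFields.BalabanUV.Beta.GAN24.LayerFluxSupport

open Finset
open scoped BigOperators
open Literature.MathematicalPhysics.QuantumFieldTheory
open Literature.MathematicalPhysics.QuantumFieldTheory.Balaban1983to89
open Literature.MathematicalPhysics.QuantumFieldTheory.Balaban1983to89.Beta
open Literature.MathematicalPhysics.QuantumFieldTheory.Balaban1983to89.B12Sec2to5 (l1 l1_nonneg)
open B6BondElimination (unitVec unitVec_apply)
open ExpKernelCalculus (MKer Site BiLoc comp Zl Zl_pos l1_sub_triangle l1_sub_symm summable_exp_shift' tsum_exp_shift')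
open OneStepResolventKernel (Fib)
open BalabanCompositeJets (LocStencil₂)
open KernelWard (divV)
open AffineAveraging (box toSite)
open AxialProjector (toSite_injective)
open Summit.QuantumFields.BalabanUV.Beta.GAN24.BlockDivergenceFlux (finsetSum_divV_eq_layers)

variable {d : ℕ}

/-! ## §1 Entries of finite sums of kernels -/

/-- Entries of a finite sum of matrix kernels. [folklore] -/
theorem finset_sum_apply4 {ι : Type*} (s : Finset ι) (K : ι → MKer (d + 1) (Fib d)) (x z : Site (d + 1)) (a b : Fib d) :
    (∑ i ∈ s, K i) x z a b = ∑ i ∈ s, K i x z a b := by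
  simp only [Finset.sum_apply]

/-- Entries of a difference of matrix kernels. [folklore] -/
theorem sub_apply4 (K L : MKer (d + 1) (Fib d)) (x z : Site (d + 1)) (a b : Fib d) :
    (K - L) x z a b = K x z a b - L x z a b := rfl

/-- Factoring a common left and right constant out of two finite sums. [folklore] -/
theorem sum_add_sum_factor {ι : Type*} (s t : Finset ι) (f : ι → ℝ) (C E : ℝ) :
    ∑ i ∈ s, C * f i * E + ∑ i ∈ t, C * f i * E = C * (∑ i ∈ s, f i + ∑ i ∈ t, f i) * E := by
  rw [mul_add, add_mul, Finset.mul_sum, Finset.mul_sum, Finset.sum_mul, Finset.sum_mul]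

/-! ## §2 The weight form: the block-summed divergence of a bi-stencil is a signed layer sum (exact) -/

/-- **(LAY) SUPPORT LEMMA (A), WEIGHT FORM.**  For a `LocStencil₂ T C δ` table and ANY finite region `B ⊂ ℤ^{d+1}`, the
block-summed divergence of the second slot `Σ_{x′∈B} divV (T κ u) x′` — the ONLY way the |S| = 1 ∕ |S| = 2 storeys read the table
(`Lin4SlotDivergence.divW_lin4_of_symm`, `E3SlotDivergence.divV_e3OfK`), rewritten as a signed sum over the discrete boundary
layer of `B` by `BlockDivergenceFlux.finsetSum_divV_eq_layers` — is bi-localised at `u` at the FULL rate `δ` with the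
`u`-dependent constant `C·ω_B(u)`, `ω_B(u) := Σ_μ (Σ_{w ∈ (B−e_μ)∖B} + Σ_{w ∈ B∖(B−e_μ)}) e^{−δ|w−u|₁}` (EXACT face weight; no
estimate lost). [folklore] -/
theorem biLoc_finsetSum_divV_weight {T : Fin (d + 1) → Site (d + 1) → Fin (d + 1) → Site (d + 1) → MKer (d + 1) (Fib d)}
    {C δ : ℝ} (hT : LocStencil₂ T C δ) (B : Finset (Site (d + 1))) (κ : Fin (d + 1)) (u : Site (d + 1)) :
    BiLoc (∑ x' ∈ B, divV (T κ u) x') u u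
      (C * ∑ μ, (∑ w ∈ B.image (fun v => v - unitVec μ) \ B, Real.exp (-δ * l1 (w - u))
              + ∑ w ∈ B \ B.image (fun v => v - unitVec μ), Real.exp (-δ * l1 (w - u)))) δ := by
  intro x z a b
  rw [finsetSum_divV_eq_layers B (T κ u), finset_sum_apply4]
  set A : ℝ := l1 (x - u) + l1 (z - u) with hA
  have hent : ∀ μ w, |T κ u μ w x z a b| ≤ C * Real.exp (-δ * l1 (w - u)) * Real.exp (-δ * A) := fun μ w =>
    hT κ u μ w x z a b
  calc |∑ μ, (∑ w ∈ B.image (fun v => v - unitVec μ) \ B, T κ u μ w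
            - ∑ w ∈ B \ B.image (fun v => v - unitVec μ), T κ u μ w) x z a b|
      ≤ ∑ μ, |(∑ w ∈ B.image (fun v => v - unitVec μ) \ B, T κ u μ w
            - ∑ w ∈ B \ B.image (fun v => v - unitVec μ), T κ u μ w) x z a b| := Finset.abs_sum_le_sum_abs _ _
    _ ≤ ∑ μ, (∑ w ∈ B.image (fun v => v - unitVec μ) \ B, C * Real.exp (-δ * l1 (w - u)) * Real.exp (-δ * A)
            + ∑ w ∈ B \ B.image (fun v => v - unitVec μ), C * Real.exp (-δ * l1 (w - u)) * Real.exp (-δ * A)) := by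
        refine Finset.sum_le_sum fun μ _ => ?_
        rw [sub_apply4, finset_sum_apply4, finset_sum_apply4]
        refine (abs_sub _ _).trans (add_le_add ?_ ?_)
        · exact (Finset.abs_sum_le_sum_abs _ _).trans (Finset.sum_le_sum fun w _ => hent μ w)
        · exact (Finset.abs_sum_le_sum_abs _ _).trans (Finset.sum_le_sum fun w _ => hent μ w)
    _ = C * (∑ μ, (∑ w ∈ B.image (fun v => v - unitVec μ) \ B, Real.exp (-δ * l1 (w - u))
              + ∑ w ∈ B \ B.image (fun v => v - unitVec μ), Real.exp (-δ * l1 (w - u))))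
          * Real.exp (-δ * A) := by
        rw [Finset.mul_sum, Finset.sum_mul]
        exact Finset.sum_congr rfl fun μ _ => sum_add_sum_factor _ _ _ _ _

/-! ## §3 The envelope: the face weight decays in the distance from the boundary layer, uniformly in `B` -/

/-- One face sum against HALF the rate: `Σ_{w∈F} e^{−δ|w−u|₁} ≤ e^{−(δ∕2)R}·Zl_{d+1}(δ∕2)` for every finite `F` all of whose
sites are at `ℓ¹`-distance `≥ R` from `u` (`0 < δ`; the full lattice sum `ExpKernelCalculus.tsum_exp_shift'` bounds the face
sum — crude but INDEPENDENT of `F`, hence of the block size). [folklore] -/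
theorem sum_exp_le_of_far {δ : ℝ} (hδ : 0 < δ) (F : Finset (Site (d + 1))) (u : Site (d + 1)) {R : ℝ}
    (hR : ∀ w ∈ F, R ≤ l1 (w - u)) :
    ∑ w ∈ F, Real.exp (-δ * l1 (w - u)) ≤ Real.exp (-(δ / 2) * R) * Zl (d + 1) (δ / 2) := by
  have hδ2 : 0 < δ / 2 := by linarith
  calc ∑ w ∈ F, Real.exp (-δ * l1 (w - u))
      ≤ ∑ w ∈ F, Real.exp (-(δ / 2) * R) * Real.exp (-(δ / 2) * l1 (w - u)) := by
        refine Finset.sum_le_sum fun w hw => ?_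
        rw [← Real.exp_add]
        exact Real.exp_le_exp.2 (by nlinarith [hR w hw, l1_nonneg (w - u)])
    _ = Real.exp (-(δ / 2) * R) * ∑ w ∈ F, Real.exp (-(δ / 2) * l1 (w - u)) := by rw [Finset.mul_sum]
    _ ≤ Real.exp (-(δ / 2) * R) * Zl (d + 1) (δ / 2) := by
        refine mul_le_mul_of_nonneg_left ?_ (Real.exp_pos _).le
        rw [← tsum_exp_shift' (c := δ / 2) u]
        exact (summable_exp_shift' hδ2 u).sum_le_tsum F fun w _ => (Real.exp_pos _).le

/-- The face weight's envelope: `ω_B(u) ≤ 2(d+1)·Zl_{d+1}(δ∕2)·e^{−(δ∕2)R}` for every witness `R` of the `ℓ¹`-distance from `u`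
to the boundary layer of `B` — INDEPENDENT of `B`. [folklore] -/
theorem faceWeight_le {δ : ℝ} (hδ : 0 < δ) (B : Finset (Site (d + 1))) (u : Site (d + 1)) {R : ℝ}
    (hR : ∀ μ w, (w ∈ B \ B.image (fun v => v - unitVec μ) ∨ w ∈ B.image (fun v => v - unitVec μ) \ B) →
      R ≤ l1 (w - u)) :
    ∑ μ, (∑ w ∈ B.image (fun v => v - unitVec μ) \ B, Real.exp (-δ * l1 (w - u))
        + ∑ w ∈ B \ B.image (fun v => v - unitVec μ), Real.exp (-δ * l1 (w - u)))
      ≤ 2 * (d + 1 : ℝ) * Zl (d + 1) (δ / 2) * Real.exp (-(δ / 2) * R) := by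
  have hface : ∀ μ, (∑ w ∈ B.image (fun v => v - unitVec μ) \ B, Real.exp (-δ * l1 (w - u))
        + ∑ w ∈ B \ B.image (fun v => v - unitVec μ), Real.exp (-δ * l1 (w - u)))
      ≤ 2 * (Real.exp (-(δ / 2) * R) * Zl (d + 1) (δ / 2)) := fun μ => by
    have h1 := sum_exp_le_of_far hδ (B.image (fun v => v - unitVec μ) \ B) u (fun w hw => hR μ w (Or.inr hw))
    have h2 := sum_exp_le_of_far hδ (B \ B.image (fun v => v - unitVec μ)) u (fun w hw => hR μ w (Or.inl hw))
    linarith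
  calc _ ≤ ∑ _μ : Fin (d + 1), 2 * (Real.exp (-(δ / 2) * R) * Zl (d + 1) (δ / 2)) := Finset.sum_le_sum fun μ _ => hface μ
    _ = _ := by rw [Finset.sum_const, Finset.card_univ, Fintype.card_fin, nsmul_eq_mul]; push_cast; ring

/-- **(LAY) SUPPORT LEMMA (A) — THE FLUX LETTER LIVES NEAR `∂B`.**  `LocStencil₂ T C δ`, `0 < δ` ⇒ for every finite region `B`,
slot `(κ, u)` and witness `R` (`hR : ∀ μ w, w ∈ layer_μ(B) → R ≤ |w − u|₁`; no `dist` defined):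
`BiLoc (Σ_{x′∈B} divV (T κ u) x′) u u (C·2(d+1)·Zl_{d+1}(δ∕2)·e^{−(δ∕2)R}) δ` — the rate in the kernel variables is KEPT at `δ`,
the layer envelope costs half the SLOT rate only; the constant is independent of `B` (block size, shape).  QR-DESIGN-v0 §3 (LAY)
«`LocStencil₂ T C δ` ⇒ `T(∇1_B, κ′u′)` is `BiLoc` at `u′` with constant `C·e^{−δ·dist(u′,∂B)∕2}`». [folklore] -/
theorem biLoc_finsetSum_divV {T : Fin (d + 1) → Site (d + 1) → Fin (d + 1) → Site (d + 1) → MKer (d + 1) (Fib d)}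
    {C δ : ℝ} (hT : LocStencil₂ T C δ) (hδ : 0 < δ) (B : Finset (Site (d + 1))) (κ : Fin (d + 1)) (u : Site (d + 1))
    {R : ℝ}
    (hR : ∀ μ w, (w ∈ B \ B.image (fun v => v - unitVec μ) ∨ w ∈ B.image (fun v => v - unitVec μ) \ B) →
      R ≤ l1 (w - u)) :
    BiLoc (∑ x' ∈ B, divV (T κ u) x') u u (C * (2 * (d + 1 : ℝ) * Zl (d + 1) (δ / 2)) * Real.exp (-(δ / 2) * R)) δ := by
  intro x z a b
  have hC : 0 ≤ C := by
    have h := (hT κ u κ u).nonneg (Sum.inr 0)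
    simpa [l1] using h
  refine (biLoc_finsetSum_divV_weight hT B κ u x z a b).trans ?_
  have hw := faceWeight_le hδ B u hR
  have := mul_le_mul_of_nonneg_left hw hC
  nlinarith [Real.exp_pos (-δ * (l1 (x - u) + l1 (z - u))), this]

/-- The geometry-free case `R = 0`: uniformly in `B`, the flux letter is as localised as the table's first slot, with constant
`C·2(d+1)·Zl_{d+1}(δ∕2)`. [folklore] -/
theorem biLoc_finsetSum_divV_zero {T : Fin (d + 1) → Site (d + 1) → Fin (d + 1) → Site (d + 1) → MKer (d + 1) (Fib d)}
    {C δ : ℝ} (hT : LocStencil₂ T C δ) (hδ : 0 < δ) (B : Finset (Site (d + 1))) (κ : Fin (d + 1)) (u : Site (d + 1)) :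
    BiLoc (∑ x' ∈ B, divV (T κ u) x') u u (C * (2 * (d + 1 : ℝ) * Zl (d + 1) (δ / 2))) δ := by
  have h := biLoc_finsetSum_divV hT hδ B κ u (R := 0) (fun μ w _ => l1_nonneg _)
  simpa using h

/-! ## §2′ The interface form (RULING R-gan24p1-g25-2 (2)): per direction, outer-face sum minus inner-face sum, EACH bounded -/

/-- ONE FACE: a finite sum of second-slot tables over any finite set `F` of slot sites is bi-localised at `u` with the exact
weight `C·Σ_{w∈F} e^{−δ|w−u|₁}` (rate `δ` kept). [folklore] -/
theorem biLoc_faceSum_weight {T : Fin (d + 1) → Site (d + 1) → Fin (d + 1) → Site (d + 1) → MKer (d + 1) (Fib d)}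
    {C δ : ℝ} (hT : LocStencil₂ T C δ) (F : Finset (Site (d + 1))) (κ : Fin (d + 1)) (u : Site (d + 1)) (μ : Fin (d + 1)) :
    BiLoc (∑ w ∈ F, T κ u μ w) u u (C * ∑ w ∈ F, Real.exp (-δ * l1 (w - u))) δ := by
  intro x z a b
  rw [finset_sum_apply4]
  refine (Finset.abs_sum_le_sum_abs _ _).trans ?_
  refine (Finset.sum_le_sum fun w _ => hT κ u μ w x z a b).trans ?_
  rw [Finset.mul_sum, Finset.sum_mul]

/-- ONE FACE, ENVELOPE: if every site of `F` is at `ℓ¹`-distance `≥ R` from `u` (`0 < δ`), the face sum is bi-localised at `u`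
with the F-free constant `C·Zl_{d+1}(δ∕2)·e^{−(δ∕2)R}`. [folklore] -/
theorem biLoc_faceSum {T : Fin (d + 1) → Site (d + 1) → Fin (d + 1) → Site (d + 1) → MKer (d + 1) (Fib d)}
    {C δ : ℝ} (hT : LocStencil₂ T C δ) (hδ : 0 < δ) (F : Finset (Site (d + 1))) (κ : Fin (d + 1)) (u : Site (d + 1))
    (μ : Fin (d + 1)) {R : ℝ} (hR : ∀ w ∈ F, R ≤ l1 (w - u)) :
    BiLoc (∑ w ∈ F, T κ u μ w) u u (C * Zl (d + 1) (δ / 2) * Real.exp (-(δ / 2) * R)) δ := by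
  intro x z a b
  have hC : 0 ≤ C := by
    have h := (hT κ u κ u).nonneg (Sum.inr 0)
    simpa [l1] using h
  refine (biLoc_faceSum_weight hT F κ u μ x z a b).trans ?_
  have hw := mul_le_mul_of_nonneg_left (sum_exp_le_of_far hδ F u hR) hC
  nlinarith [Real.exp_pos (-δ * (l1 (x - u) + l1 (z - u))), hw]

/-- **THE INTERFACE FORM OF THE FLUX LETTER** (primary statement handed to (LT); RULING R-gan24p1-g25-2 (2)): the block-summed
divergence IS, per direction `μ`, the OUTER-face sum minus the INNER-face sum of the SAME table
(`BlockDivergenceFlux.finsetSum_divV_eq_layers`, restated here at the storeys' type), and EACH face sum obeys `biLoc_faceSum_weight` ∕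
`biLoc_faceSum` separately — unsummed, no weight folded.  The total `BiLoc` bounds of §2–§4 are the corollary. [folklore] -/
theorem finsetSum_divV_eq_faceDiff (T : Fin (d + 1) → Site (d + 1) → Fin (d + 1) → Site (d + 1) → MKer (d + 1) (Fib d))
    (B : Finset (Site (d + 1))) (κ : Fin (d + 1)) (u : Site (d + 1)) :
    ∑ x' ∈ B, divV (T κ u) x'
      = ∑ μ, (∑ w ∈ B.image (fun v => v - unitVec μ) \ B, T κ u μ w - ∑ w ∈ B \ B.image (fun v => v - unitVec μ), T κ u μ w) :=
  finsetSum_divV_eq_layers B (T κ u)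

/-! ## §4 One block: the storeys' literal input -/

/-- The block sum over the fine sites of the block of label `y` at blocking `N` is a sum over a finite region of `ℤ^{d+1}`
(the block parametrisation `v ↦ N•y + toSite v` is injective). [folklore] -/
theorem boxSum_divV_eq_finsetSum (N : ℕ) (S : Fin (d + 1) → Site (d + 1) → MKer (d + 1) (Fib d)) (y : Site (d + 1)) :
    ∑ v ∈ box (d + 1) N, divV S ((N : ℤ) • y + toSite v)
      = ∑ x' ∈ (box (d + 1) N).image (fun v => (N : ℤ) • y + toSite v), divV S x' := by
  rw [Finset.sum_image fun v _ w _ h => toSite_injective (add_left_cancel h)]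

/-- **(A) FOR ONE BLOCK** — the literal block-summed input `Σ_{v∈box} divV (T κ u) (N•y + toSite v)` of
`Lin4SlotDivergence.divW_lin4_of_symm` ∕ `E3SlotDivergence.divV_e3OfK` ∕ `BlockDivergenceFlux.divW_lin4_of_symm_faceFlux`:
`BiLoc` at `u`, rate `δ`, constant `C·2(d+1)·Zl_{d+1}(δ∕2)·e^{−(δ∕2)R}` for every witness `R` of the `ℓ¹`-distance from `u` to the
boundary layer of the block (its `2(d+1)` faces of `N^d` sites each, `BlockDivergenceFlux.card_face_eq`) — INDEPENDENT of `N`. [folklore] -/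
theorem biLoc_boxSum_divV {T : Fin (d + 1) → Site (d + 1) → Fin (d + 1) → Site (d + 1) → MKer (d + 1) (Fib d)}
    {C δ : ℝ} (hT : LocStencil₂ T C δ) (hδ : 0 < δ) (N : ℕ) (y : Site (d + 1)) (κ : Fin (d + 1)) (u : Site (d + 1))
    {R : ℝ}
    (hR : ∀ μ w, (w ∈ (box (d + 1) N).image (fun v => (N : ℤ) • y + toSite v)
                      \ ((box (d + 1) N).image (fun v => (N : ℤ) • y + toSite v)).image (fun v => v - unitVec μ)
                 ∨ w ∈ ((box (d + 1) N).image (fun v => (N : ℤ) • y + toSite v)).image (fun v => v - unitVec μ)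
                      \ (box (d + 1) N).image (fun v => (N : ℤ) • y + toSite v)) → R ≤ l1 (w - u)) :
    BiLoc (∑ v ∈ box (d + 1) N, divV (T κ u) ((N : ℤ) • y + toSite v)) u u
      (C * (2 * (d + 1 : ℝ) * Zl (d + 1) (δ / 2)) * Real.exp (-(δ / 2) * R)) δ := by
  rw [boxSum_divV_eq_finsetSum]
  exact biLoc_finsetSum_divV hT hδ _ κ u hR

/-- One block, geometry-free (`R = 0`): uniformly in `N` and `y`. [folklore] -/
theorem biLoc_boxSum_divV_zero {T : Fin (d + 1) → Site (d + 1) → Fin (d + 1) → Site (d + 1) → MKer (d + 1) (Fib d)}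
    {C δ : ℝ} (hT : LocStencil₂ T C δ) (hδ : 0 < δ) (N : ℕ) (y : Site (d + 1)) (κ : Fin (d + 1)) (u : Site (d + 1)) :
    BiLoc (∑ v ∈ box (d + 1) N, divV (T κ u) ((N : ℤ) • y + toSite v)) u u
      (C * (2 * (d + 1 : ℝ) * Zl (d + 1) (δ / 2))) δ := by
  rw [boxSum_divV_eq_finsetSum]
  exact biLoc_finsetSum_divV_zero hT hδ _ κ u

end Summit.QuantumFields.BalabanUV.Beta.GAN24.LayerFluxSupport
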